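/-
Copyright (c) 2026. All rights reserved.
Released under Apache 2.0 license as described in the file LICENSE.
Authors: abc-iut cell, wave-5 prover seat abc-iut-w5-d019 (gen 5).
-/
import Literature.IUT.LogVolume.LogSeriesEstimates
import HarnessLib

/-!
# `log_p(𝒪_K^×)` is a closed ball as soon as every unit is a root of unity times a deep principal unit

Proof-only companion of `LocalUnitLog.lean` / `LogSeriesEstimates.lean` (abc-iut-S1: the `p`-adic
logarithm `unitLog = log_p : 𝒪_K^× → K` of a mixed-characteristic local field in the norm-side setting
`[NormedAlgebra ℚ_[p] K] [IsUltrametricDist K] [ProperSpace K]`, [IUTchIV] §1 Prop. 1.2 p. 10), supplying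
the classical mechanism by which the image `log_p(R^×)` is computed EXACTLY in the presence of `p`-power
torsion (Neukirch, *Algebraic Number Theory*, Ch. II (5.5)–(5.7): `log_p` kills `μ(K)` and is an isometry
`U^{(n)} ⥲ 𝔪^n` for `n > e/(p−1)`):

* `norm_eq_one_of_pow_eq_one'` — a root of unity has norm `1`;
* `norm_unitLog_le_of_exists_root_mul` — if `‖u‖ = 1` and `‖1 − η·u‖ ≤ r` for some root of unity `η`
  and a radius `r` with `r · p^{1/(p−1)} ≤ 1`, then `‖log_p u‖ ≤ r` (`log_p u = log_p(η u) = L(η u)` and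
  the Lipschitz bound `norm_logSeries_le_norm`);
* `logUnits_subset_closedBall_of_forall_exists_root_mul` — if EVERY unit admits such an `η`, then
  `log_p(R^×) ⊆ {‖z‖ ≤ r}`;
* `closedBall_subset_logUnits_of_mul_rpow_lt_one` — for `r · p^{1/(p−1)} < 1`, `{‖z‖ ≤ r} ⊆ log_p(R^×)`
  (successive approximation, `exists_logSeries_eq`; the radius-`r` form of `closedBall_subset_logUnits`);
* `logUnits_eq_closedBall_of_forall_exists_root_mul` — hence, under both hypotheses,
  **`log_p(R^×) = {‖z‖ ≤ r}`**, a closed ball (so every rescaling `c · log_p(R^×)`, in particular the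
  log-shell `(p^*)⁻¹ · log_p(R^×)` of [IUTchIII] Def. 1.1 (i), is a ball `c' · R`).

Typical instance (the consumer that prompted this file, cell gap row G-c312-14-1, Team R ramified-mover
thread of seat abc-iut-c312-14, `K₃`-specific file by seat abc-iut-w4-d017): `K = ℚ₃(ζ₃)` with the
`ℚ₃`-algebra norm (`‖3‖ = 3⁻¹`, `‖ζ₃ − 1‖ = 3^{−1/2}`), `r = 3⁻¹`, `η ∈ μ₆`: the residue field is `𝔽₃` and
`1 + 𝔪 = μ₃ · (1 + 𝔪²)`, so every unit is `η · y` with `‖1 − y‖ ≤ 3⁻¹`, and `3⁻¹ · 3^{1/2} < 1`; hence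
`log₃(𝒪^×) = {‖z‖ ≤ 3⁻¹} = 3𝒪` and the log-shell `3⁻¹ · log₃(𝒪^×)` is `𝒪` itself.

Classical and undisputed; nothing here takes a side on [IUTchIII] Cor. 3.12.
-/

noncomputable section

open Metric IsUltrametricDist

namespace Literature.IUT.LogVolume

variable (p : ℕ) [Fact p.Prime]

/-- A radius `r` with `r · p^{1/(p−1)} ≤ 1` is `< 1` (as `p^{1/(p−1)} > 1`): balls of such radius around
`1` consist of principal units. [cite: NeukirchANT1999, Ch. II Prop. (5.5)] -/
theorem lt_one_of_mul_rpow_le_one {r : ℝ} (hθ : r * (p : ℝ) ^ (1 / ((p : ℝ) - 1)) ≤ 1) : r < 1 := by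
  have hp1 : (1 : ℝ) < p := by exact_mod_cast (Fact.out : p.Prime).one_lt
  have hq1 : 1 < (p : ℝ) ^ (1 / ((p : ℝ) - 1)) :=
    Real.one_lt_rpow hp1 (div_pos one_pos (by linarith))
  by_contra hr
  have hr' : 1 ≤ r := not_lt.mp hr
  have : (1 : ℝ) * (p : ℝ) ^ (1 / ((p : ℝ) - 1)) ≤ r * (p : ℝ) ^ (1 / ((p : ℝ) - 1)) := by
    gcongr
  linarith

variable {K : Type*} [NontriviallyNormedField K]

/-- A root of unity of a normed field has norm `1` (`‖η‖ⁿ = ‖ηⁿ‖ = 1`, `n ≥ 1`).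
[cite: NeukirchANT1999, Ch. II Prop. (5.7)] -/
theorem norm_eq_one_of_pow_eq_one' {η : K} {n : ℕ} (hn : 0 < n) (h : η ^ n = 1) : ‖η‖ = 1 := by
  have h1 : ‖η‖ ^ n = 1 := by rw [← norm_pow, h, norm_one]
  exact (pow_eq_one_iff_of_nonneg (norm_nonneg η) hn.ne').mp h1

variable [instK : NormedAlgebra ℚ_[p] K] [IsUltrametricDist K] [ProperSpace K]
include instK

/-- **Root-of-unity twist**: if `‖u‖ = 1` and some root of unity `η` brings `u` into the ball
`‖1 − η·u‖ ≤ r`, `r · p^{1/(p−1)} ≤ 1`, then `‖log_p u‖ ≤ r` — because `log_p η = 0`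
(`unitLog_eq_zero_of_pow_eq_one`), `log_p(η u) = log_p η + log_p u` (`unitLog_mul`), on the principal
unit `η u` the logarithm is the series `L` (`unitLog_of_isPrincipal`), and `‖L(y)‖ ≤ ‖1 − y‖` there
(`norm_logSeries_le_norm`). [cite: NeukirchANT1999, Ch. II Prop. (5.5)] -/
theorem norm_unitLog_le_of_exists_root_mul {r : ℝ} (hθ : r * (p : ℝ) ^ (1 / ((p : ℝ) - 1)) ≤ 1)
    {u : K} (hu : ‖u‖ = 1)
    (h : ∃ η : K, (∃ n : ℕ, 0 < n ∧ η ^ n = 1) ∧ ‖1 - η * u‖ ≤ r) :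
    ‖unitLog u‖ ≤ r := by
  obtain ⟨η, ⟨n, hn, hηn⟩, hr⟩ := h
  have hη : ‖η‖ = 1 := norm_eq_one_of_pow_eq_one' hn hηn
  have hP : IsPrincipal (η * u) := lt_of_le_of_lt hr (lt_one_of_mul_rpow_le_one p hθ)
  have h1 : unitLog (η * u) = unitLog η + unitLog u := unitLog_mul p hη hu
  have h2 : unitLog η = 0 := unitLog_eq_zero_of_pow_eq_one p hn hηn
  have h3 : unitLog u = logSeries (η * u) := by
    rw [← unitLog_of_isPrincipal p hP, h1, h2, zero_add]
  rw [h3]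
  exact (norm_logSeries_le_norm p K hθ hr).trans hr

/-- **`log_p(R^×) ⊆ {‖z‖ ≤ r}`** as soon as every unit is a root of unity times an element of the ball
`‖1 − y‖ ≤ r` (`r · p^{1/(p−1)} ≤ 1`). [cite: NeukirchANT1999, Ch. II Prop. (5.5)] -/
theorem logUnits_subset_closedBall_of_forall_exists_root_mul {r : ℝ}
    (hθ : r * (p : ℝ) ^ (1 / ((p : ℝ) - 1)) ≤ 1)
    (h : ∀ u : K, ‖u‖ = 1 → ∃ η : K, (∃ n : ℕ, 0 < n ∧ η ^ n = 1) ∧ ‖1 - η * u‖ ≤ r) :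
    logUnits K ⊆ closedBall 0 r := by
  rintro _ ⟨u, hu, rfl⟩
  rw [Set.mem_setOf_eq] at hu
  rw [mem_closedBall, dist_zero_right]
  exact norm_unitLog_le_of_exists_root_mul p hθ hu (h u hu)

omit [ProperSpace K] in
/-- **`{‖z‖ ≤ r} ⊆ log_p(R^×)`** for `r · p^{1/(p−1)} < 1` and complete `K`: every such `z` is `L(u)` for a
`u` with `‖1 − u‖ ≤ r` (successive approximation, `exists_logSeries_eq`), a principal unit, where
`log_p = L`. (Radius-`r` form of `closedBall_subset_logUnits`.) [cite: NeukirchANT1999, Ch. II Prop. (5.5)] -/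
theorem closedBall_subset_logUnits_of_mul_rpow_lt_one [CompleteSpace K] {r : ℝ}
    (hθ : r * (p : ℝ) ^ (1 / ((p : ℝ) - 1)) < 1) :
    closedBall (0 : K) r ⊆ logUnits K := by
  intro z hz
  rw [mem_closedBall, dist_zero_right] at hz
  obtain ⟨u, hu, huz⟩ := exists_logSeries_eq p K hθ hz
  have huP : IsPrincipal u := lt_of_le_of_lt hu (lt_one_of_mul_rpow_le_one p hθ.le)
  exact ⟨u, huP.norm_eq_one, by rw [unitLog_of_isPrincipal p huP, huz]⟩

/-- **`log_p(R^×) = {‖z‖ ≤ r}` exactly** when `r · p^{1/(p−1)} < 1` and every unit is a root of unity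
times an element of `‖1 − y‖ ≤ r` — the image of the `p`-adic logarithm on units is then a CLOSED BALL
(Neukirch II (5.5)/(5.7): `log_p` kills `μ(K)` and maps `U^{(n)}` isomorphically onto `𝔪ⁿ` for
`n > e/(p−1)`; here `U^{(n)}` is replaced by the metric ball of radius `r`).
[cite: NeukirchANT1999, Ch. II Prop. (5.7)] -/
theorem logUnits_eq_closedBall_of_forall_exists_root_mul {r : ℝ}
    (hθ : r * (p : ℝ) ^ (1 / ((p : ℝ) - 1)) < 1)
    (h : ∀ u : K, ‖u‖ = 1 → ∃ η : K, (∃ n : ℕ, 0 < n ∧ η ^ n = 1) ∧ ‖1 - η * u‖ ≤ r) :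
    logUnits K = closedBall 0 r :=
  Set.Subset.antisymm (logUnits_subset_closedBall_of_forall_exists_root_mul p hθ.le h)
    (closedBall_subset_logUnits_of_mul_rpow_lt_one p hθ)

/-- Rescaled form for consumers of the log-shell `c · log_p(R^×)` (e.g. `c = (p^*)⁻¹`, [IUTchIII]
Def. 1.1 (i)): under the hypotheses of `logUnits_eq_closedBall_of_forall_exists_root_mul`,
`c · log_p(R^×) = c · {‖z‖ ≤ r}` — a ball (of radius `‖c‖ · r`). [cite: NeukirchANT1999, Ch. II Prop. (5.7)] -/
theorem smul_logUnits_eq_of_forall_exists_root_mul {r : ℝ}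
    (hθ : r * (p : ℝ) ^ (1 / ((p : ℝ) - 1)) < 1)
    (h : ∀ u : K, ‖u‖ = 1 → ∃ η : K, (∃ n : ℕ, 0 < n ∧ η ^ n = 1) ∧ ‖1 - η * u‖ ≤ r) (c : K) :
    (fun z => c * z) '' logUnits K = (fun z => c * z) '' closedBall 0 r := by
  rw [logUnits_eq_closedBall_of_forall_exists_root_mul p hθ h]

end Literature.IUT.LogVolume

end
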